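import Summits.QuantumFields.BalabanUV.Beta.GAN24.SourcePairingLevelOneExplicit
import Summits.QuantumFields.BalabanUV.Beta.GAN24.SourcePairingTowerClosed

/-!
# `BalabanUV.Beta.GAN24.SourcePairingLevelExplicit` — binder row G-an2-4 ∕ (CONV-C), the (S) row ∕ (W-γ) one level up, the β-CHAIN (levels ≥ 2), FILE F3′ (the last of the `hX` programme):
# **ROAD-P2's `hX` AT EVERY LEVEL `j` — the column pairing of `ExplicitSourceFormLambdaShare.moments_sigmaPair_exit_succ_of_columnPairing`, at Bałaban's pins, for the explicit
# source form `n⋆`** (`Lc` odd, centred root, `cE = Lc^{d+1}`, `cVH = −Lc^{d+1}·½·Lc^{d+1}`, every `cΛ`, `α ≠ β`, EVERY `j`)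
# (G-an2-4 CRUX TEAM (2), seat `b2b-balaban-gan24-formalise-leaf-06` = the (γ) hand, gen 50, journal A-8 l.51268)

NOT IN PRINT; OUR BOOKKEEPING ([folklore] BY NAME over TODAY's F2c `SourcePairingTowerClosed.sourcePairing_tower_closed` (the closed form at every level for the tower class) at `P := Lc`
for the two-level slot datum `h = colH G_{j+1}(ν, y′)` (in the class by (E3) `DataColumnCombRows.E2row_colH_eq_contourSumAdj_colM_succ`), road-P2 g44∕g45's `ExplicitSourceFormPeriodic`
(`n⋆` bounded and `Lc`-periodic) and (ΛS) `ExplicitSourceFormLambdaShare.contourSum_bondSum_blockInd_explicitSourceForm_eq_zero` ∕ `axProjAt_explicitPotential_eq_self`, A-4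
`SourcePairingLevelOneExplicit.tsum_exitInd_mul_wΦ_eq_zero` (the exit indicator reads nothing on `wΦ_N`, any `N`), g46 `RelInvWardPairing.tsum_mul_contourSumAdj_bdd`; 0 `def`, 0 cited fact,
0 `def … : Prop`, 0 sorry).  AT `j := 0` §3 IS A-4's `columnPairing_levelOne_explicitSourceForm` VERBATIM (`0 + 1` syntactics).
HONEST FRAMING (cell contract, verbatim): «discharging `BetaPertH` makes Bałaban's UV stability UNCONDITIONAL — a real constructive-QFT result; it is NOT the continuum limit and NOT
the Clay problem.»  HONEST DEPENDENCY (verbatim): «continuum YM on T⁴ ⇐ BetaPertH ∧ nine spine estimates (0/9 proved); BetaPertH ⇐ (D1) ∧ (D4) ∧ CAP+tail; G-an2-4 gates asym,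
D1 and NE2/3/4.»

WHY.  Road-P2's theorem is generic in `j cE cVH cΛ`; its displayed hypothesis `hX` at level `j` is the closed form of the (γ) source pairing `X_{j+1}(colH G_{j+1}(ν,y′); n⋆, 𝟙_{B(y)})`
against the exit⊗exit charge; A-4 discharged `j = 0` over the two-level closed form, THIS FILE discharges EVERY `j` over the tower closed form: §1 `C_j n⋆ = C_j(c·Π^ρ m̃)` (the exit
indicator reads nothing on `wΦ_{Lc^{j+1}}`), §2 the `σ`-term dies ((E3) + adjointness + (ΛS)) and the two-level datum is in the tower class, §3 the assembly with the weights
`Lc^{d+1}·wE_{j+1} = stepScale_{j+1}·Lc^{d+1}·wVH_{j+1}`.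
* §1 `multResponse_explicitSourceForm_eq_level`; §2 `sigmaWeight_multResponse_explicitSourceForm_eq_zero_level`, `twoLevel_mem_towerClass`; §3 **`columnPairing_explicitSourceForm`** (every `j`).
Asserts NO value of any resolvent column beyond (T1) + FILE F + (γ) + (α); with road-P2's theorem this makes the exit⊗exit σ-pair (S) row a theorem AT EVERY LEVEL (their file to
write); NOTHING of (W-γ)_{≥2}'s other rows ∕ (INV) ∕ (Π) discharged; NEVER «G-an2-4 closed» as (CONV-C); NOT D1, NOT `BetaPertH`, NOT continuum, NOT Clay.  2026-08-23; no existing file touched.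
-/

noncomputable section

open Finset
open scoped BigOperators
open Literature.MathematicalPhysics.QuantumFieldTheory
open Literature.MathematicalPhysics.QuantumFieldTheory.Balaban1983to89
open Literature.MathematicalPhysics.QuantumFieldTheory.Balaban1983to89.Beta
open B12Sec2to5 (l1 l1_nonneg)
open ExpKernelCalculus (Site MKer Decays Zl summable_exp_shift')
open OneStepResolventKernel (Fib)
open LatticeForm (quo)
open AffineAveraging (Form1 box toSite unitVec unitVec_apply dz contourSum)
open AffineReproduction (contourSumAdj)
open AveragingContours (blk)
open AveragingContoursRooted (ctrOff ctrOff_mem_box)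
open RootedComb (axProjAt)
open KernelSpecInstance (wΦ)
open OneStepKernelFamily (KInvStep colH)
open SecondOrderResponse (colM)
open BalabanStepJetsSucc (wE wVH)
open Summit.QuantumFields.BalabanUV.Beta.AxialDressingRooted (coDressKBmAt decays_coDressKBmAt_KInvStep spr_coDressKBmAt one_le_of_neZero)
open Summit.QuantumFields.BalabanUV.Beta.BorderedHessian (stepScale spr_KInvStep)
open Summit.QuantumFields.BalabanUV.Beta.SpineRooted (S0NAt e3OfK SpureRecAt)
open Summit.QuantumFields.BalabanUV.Beta.WardLocusRecursive (SrecAt SrecAt_zero)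
open Summit.QuantumFields.BalabanUV.Beta.KernelWardMColumn (colM_coDressKBmAt)
open Summit.QuantumFields.BalabanUV.Beta.GAN24.MultiplierZeroMass (colM_KInvStep summable_wΦ tsum_wΦ_sub_left)
open Summit.QuantumFields.BalabanUV.Beta.GAN24.MultiplierVertexBondSum (abs_colM_le_fine)
open Summit.QuantumFields.BalabanUV.Beta.GAN24.MultiplierColumnCoarseGauge (tsum_wΦ_mul_grad_eq_zero_bdd)
open Summit.QuantumFields.BalabanUV.Beta.GAN24.CoarseGaugeSourceResponse (summable_bdd_mul)
open Summit.QuantumFields.BalabanUV.Beta.GAN24.RelInvWardPairing (tsum_mul_contourSumAdj_bdd summable_abs_comp_quo)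
open Summit.QuantumFields.BalabanUV.Beta.GAN24.ChargeTowerClimb (summable_colH)
open Summit.QuantumFields.BalabanUV.Beta.GAN24.DataColumnCombRows (E2row_colH_eq_contourSumAdj_colM_succ)
open Summit.QuantumFields.BalabanUV.Beta.GAN24.ExplicitSourceFormLambdaShare (axProjAt_explicitPotential_eq_self contourSum_bondSum_blockInd_explicitSourceForm_eq_zero)
open Summit.QuantumFields.BalabanUV.Beta.GAN24.ExplicitSourceFormPeriodic (exists_abs_le_of_blockPeriodic explicitPotential_blockPeriodic explicitSourceForm_blockPeriodic
  exists_abs_explicitSourceForm_le)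
open Summit.QuantumFields.BalabanUV.Beta.GAN24.SourcePairingLevelOneClosed (abs_multResponse_le slotSum_mul_colM_eq)
open Summit.QuantumFields.BalabanUV.Beta.GAN24.SourcePairingLevelOneExplicit (tsum_exitInd_mul_wΦ_eq_zero)
open Summit.QuantumFields.BalabanUV.Beta.GAN24.SourcePairingTowerClosed (sourcePairing_tower_closed)

namespace Summit.QuantumFields.BalabanUV.Beta.GAN24.SourcePairingLevelExplicit

variable {d : ℕ} {Lc : ℕ} [NeZero Lc]

/-! ## §1 The multiplier response of the explicit source form, every level -/

/-- NOT IN PRINT; OUR BOOKKEEPING.  **THE MULTIPLIER RESPONSE OF `n⋆` IS THAT OF `c·Π^ρ m̃`, AT EVERY LEVEL** (in-block root `ρ = toSite r`, every `j`, every `c α β`, every multiplier bond `(l, t)` of `G_j`):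
`Σ_κ₀ Σ'_u n⋆ κ₀ u·colM G_j Lc κ₀ u l t = Σ'_v Σ_l′ wΦ_{Lc^{j+1}} l l′ (t − v)·(c·Π^ρ m̃)(l′,v)` — `Π^ρ(c·Π^ρ m̃) = c·Π^ρ m̃`, the exit-indicator correction reads nothing (§1), `colM G_0 = wΦ_{Lc}`. -/
theorem multResponse_explicitSourceForm_eq_level {r : Fin (d + 1) → ℕ} (hr : r ∈ box (d + 1) Lc) (j : ℕ) (c : ℝ) (α β : Fin (d + 1)) (l : Fin (d + 1)) (t : Site (d + 1)) :
    ∑ κ₀, ∑' u : Site (d + 1),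
        (axProjAt (toSite r) Lc
            (fun l v => c * axProjAt (toSite r) Lc
              (fun l x => (if l = α then ((Lc : ℝ) ^ 2)⁻¹ * (((x β % (Lc : ℤ) : ℤ)) : ℝ) else 0)
                - (if l = β then (Lc : ℝ)⁻¹ * (if x β % (Lc : ℤ) = (Lc : ℤ) - 1 then (1 : ℝ) else 0) * (((x α % (Lc : ℤ) : ℤ)) : ℝ) else 0)) l v) κ₀ u
          - ((Lc : ℝ) ^ (d + 1))⁻¹ * (contourSum Lc
            (fun l v => c * axProjAt (toSite r) Lc
              (fun l x => (if l = α then ((Lc : ℝ) ^ 2)⁻¹ * (((x β % (Lc : ℤ) : ℤ)) : ℝ) else 0)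
                - (if l = β then (Lc : ℝ)⁻¹ * (if x β % (Lc : ℤ) = (Lc : ℤ) - 1 then (1 : ℝ) else 0) * (((x α % (Lc : ℤ) : ℤ)) : ℝ) else 0)) l v) κ₀ 0
            * (if u κ₀ % (Lc : ℤ) = (Lc : ℤ) - 1 then (1 : ℝ) else 0)))
        * colM (coDressKBmAt (toSite r) Lc (KInvStep (d := d) Lc j)) Lc κ₀ u l t
      = ∑' v : Site (d + 1), ∑ l' : Fin (d + 1), wΦ (N := Lc ^ (j + 1)) l l' (t - v)
          * (c * axProjAt (toSite r) Lc
              (fun l x => (if l = α then ((Lc : ℝ) ^ 2)⁻¹ * (((x β % (Lc : ℤ) : ℤ)) : ℝ) else 0)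
                - (if l = β then (Lc : ℝ)⁻¹ * (if x β % (Lc : ℤ) = (Lc : ℤ) - 1 then (1 : ℝ) else 0) * (((x α % (Lc : ℤ) : ℤ)) : ℝ) else 0)) l' v) := by
  classical
  have hLc1 : 1 ≤ Lc := one_le_of_neZero Lc
  -- abbreviations
  set P : Form1 (d + 1) ℝ := fun l v => c * axProjAt (toSite r) Lc
      (fun l x => (if l = α then ((Lc : ℝ) ^ 2)⁻¹ * (((x β % (Lc : ℤ) : ℤ)) : ℝ) else 0)
        - (if l = β then (Lc : ℝ)⁻¹ * (if x β % (Lc : ℤ) = (Lc : ℤ) - 1 then (1 : ℝ) else 0) * (((x α % (Lc : ℤ) : ℤ)) : ℝ) else 0)) l v with hP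
  -- `Π^ρ P = P`
  have hProj : axProjAt (toSite r) Lc P = P := by
    rw [hP]; exact axProjAt_explicitPotential_eq_self hLc1 hr _ c
  -- `P` is bounded (block-periodic)
  obtain ⟨BP, hBP⟩ := exists_abs_le_of_blockPeriodic hLc1 P (fun l v z => explicitPotential_blockPeriodic (toSite r) c α β l v z)
  -- the multiplier column in the `wΦ` letters, and its summability in the data index
  have hcol : ∀ κ₀ (u : Site (d + 1)), colM (coDressKBmAt (toSite r) Lc (KInvStep (d := d) Lc j)) Lc κ₀ u l t = wΦ (N := Lc ^ (j + 1)) l κ₀ (t - u) := fun κ₀ u => by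
    rw [colM_coDressKBmAt, colM_KInvStep]
  have hws : ∀ κ₀, Summable fun u : Site (d + 1) => wΦ (N := Lc ^ (j + 1)) (d := d) l κ₀ (t - u) := fun κ₀ => by
    have h := (Equiv.subLeft t).summable_iff.2 (summable_wΦ (N := Lc ^ (j + 1)) (d := d) l κ₀)
    exact h.congr fun u => by simp [Equiv.subLeft]
  have hsP : ∀ κ₀, Summable fun u : Site (d + 1) => P κ₀ u * wΦ (N := Lc ^ (j + 1)) (d := d) l κ₀ (t - u) := fun κ₀ =>
    summable_bdd_mul (hws κ₀) (fun u => hBP κ₀ u)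
  have hsE : ∀ κ₀, Summable fun u : Site (d + 1) =>
      ((Lc : ℝ) ^ (d + 1))⁻¹ * (contourSum Lc P κ₀ 0 * (if u κ₀ % (Lc : ℤ) = (Lc : ℤ) - 1 then (1 : ℝ) else 0)) * wΦ (N := Lc ^ (j + 1)) (d := d) l κ₀ (t - u) :=
    fun κ₀ => summable_bdd_mul (hws κ₀) (fun u => show |((Lc : ℝ) ^ (d + 1))⁻¹ * (contourSum Lc P κ₀ 0 * (if u κ₀ % (Lc : ℤ) = (Lc : ℤ) - 1 then (1 : ℝ) else 0))|
        ≤ |((Lc : ℝ) ^ (d + 1))⁻¹ * contourSum Lc P κ₀ 0| by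
      rw [abs_mul, abs_mul, abs_mul]
      refine mul_le_mul_of_nonneg_left ?_ (abs_nonneg _)
      exact mul_le_of_le_one_right (abs_nonneg _) (by split_ifs <;> simp))
  -- rewrite the statement in the abbreviations
  show (∑ κ₀, ∑' u : Site (d + 1), (axProjAt (toSite r) Lc P κ₀ u
      - ((Lc : ℝ) ^ (d + 1))⁻¹ * (contourSum Lc P κ₀ 0 * (if u κ₀ % (Lc : ℤ) = (Lc : ℤ) - 1 then (1 : ℝ) else 0)))
        * colM (coDressKBmAt (toSite r) Lc (KInvStep (d := d) Lc j)) Lc κ₀ u l t)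
      = ∑' v : Site (d + 1), ∑ l' : Fin (d + 1), wΦ (N := Lc ^ (j + 1)) l l' (t - v) * P l' v
  rw [hProj]
  simp only [hcol]
  -- split the data leg: the `P` part and the exit-indicator correction
  have e1 : ∀ κ₀, (∑' u : Site (d + 1), (P κ₀ u - ((Lc : ℝ) ^ (d + 1))⁻¹ * (contourSum Lc P κ₀ 0 * (if u κ₀ % (Lc : ℤ) = (Lc : ℤ) - 1 then (1 : ℝ) else 0)))
        * wΦ (N := Lc ^ (j + 1)) (d := d) l κ₀ (t - u))
      = ∑' u : Site (d + 1), P κ₀ u * wΦ (N := Lc ^ (j + 1)) (d := d) l κ₀ (t - u) := by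
    intro κ₀
    have esub : (fun u : Site (d + 1) => (P κ₀ u - ((Lc : ℝ) ^ (d + 1))⁻¹ * (contourSum Lc P κ₀ 0 * (if u κ₀ % (Lc : ℤ) = (Lc : ℤ) - 1 then (1 : ℝ) else 0)))
          * wΦ (N := Lc ^ (j + 1)) (d := d) l κ₀ (t - u))
        = fun u => P κ₀ u * wΦ (N := Lc ^ (j + 1)) (d := d) l κ₀ (t - u)
          - ((Lc : ℝ) ^ (d + 1))⁻¹ * (contourSum Lc P κ₀ 0 * (if u κ₀ % (Lc : ℤ) = (Lc : ℤ) - 1 then (1 : ℝ) else 0)) * wΦ (N := Lc ^ (j + 1)) (d := d) l κ₀ (t - u) := by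
      funext u; ring
    rw [esub, Summable.tsum_sub (hsP κ₀) (hsE κ₀)]
    have ez : (∑' u : Site (d + 1), ((Lc : ℝ) ^ (d + 1))⁻¹ * (contourSum Lc P κ₀ 0 * (if u κ₀ % (Lc : ℤ) = (Lc : ℤ) - 1 then (1 : ℝ) else 0))
        * wΦ (N := Lc ^ (j + 1)) (d := d) l κ₀ (t - u)) = 0 := by
      have e2 : (fun u : Site (d + 1) => ((Lc : ℝ) ^ (d + 1))⁻¹ * (contourSum Lc P κ₀ 0 * (if u κ₀ % (Lc : ℤ) = (Lc : ℤ) - 1 then (1 : ℝ) else 0))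
            * wΦ (N := Lc ^ (j + 1)) (d := d) l κ₀ (t - u))
          = fun u => (((Lc : ℝ) ^ (d + 1))⁻¹ * contourSum Lc P κ₀ 0)
            * ((if u κ₀ % (Lc : ℤ) = (Lc : ℤ) - 1 then (1 : ℝ) else 0) * wΦ (N := Lc ^ (j + 1)) (d := d) l κ₀ (t - u)) := by
        funext u; ring
      rw [e2, tsum_mul_left, tsum_exitInd_mul_wΦ_eq_zero (Lc := Lc) (N := Lc ^ (j + 1)) l κ₀ t, mul_zero]
    rw [ez, sub_zero]
  rw [Finset.sum_congr rfl fun κ₀ _ => e1 κ₀, ← Summable.tsum_finsetSum (fun κ₀ _ => hsP κ₀)]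
  exact tsum_congr fun u => Finset.sum_congr rfl fun κ₀ _ => by ring
/-! ## §2 The `σ`-term vanishes at the explicit source form, every level; the two-level slot datum is in the tower class -/

/-- NOT IN PRINT; OUR BOOKKEEPING.  **THE `σ`-TERM OF THE CLOSED FORM VANISHES AT `n⋆`, AT EVERY LEVEL** (`Lc` odd is NOT needed here; centred root `ρ = toSite (ctrOff (d+1) Lc)`, `α ≠ β`,
every `j`, every slot `(ν, y′)` of `G_{j+1}`, every `c`, every block label `y`): with `h = colH G_{j+1} Lc ν y′`,
`Σ'_Y Σ_κ (Σ_l Σ'_t h l t·colM G_j Lc l t κ Y)·((1_{B(y)}(Y) + 1_{B(y)}(Y+e_κ))·n⋆ κ Y) = 0`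
— (E3) makes `C_j h` the coarse gradient `(stepScale_{j+1}∕wVH_{j+1})·𝒬ᵀ(colM G_{j+1}(ν,y′))`, adjointness moves `𝒬` onto `σ⊙n⋆`, and (ΛS) `𝒬(σ_{1_{B(y)}}⊙n⋆) = 0`. -/
theorem sigmaWeight_multResponse_explicitSourceForm_eq_zero_level (j : ℕ) {α β : Fin (d + 1)} (hαβ : α ≠ β) (c : ℝ) (ν : Fin (d + 1)) (y' y : Site (d + 1)) :
    ∑' Y : Site (d + 1), ∑ κ : Fin (d + 1),
        (∑ l, ∑' t : Site (d + 1), colH (coDressKBmAt (toSite (ctrOff (d + 1) Lc)) Lc (KInvStep (d := d) Lc (j + 1))) Lc ν y' l t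
            * colM (coDressKBmAt (toSite (ctrOff (d + 1) Lc)) Lc (KInvStep (d := d) Lc j)) Lc l t κ Y)
          * (((if blk Lc Y = y then (1 : ℝ) else 0) + (if blk Lc (Y + unitVec κ) = y then (1 : ℝ) else 0))
            * (axProjAt (toSite (ctrOff (d + 1) Lc)) Lc
                (fun l v => c * axProjAt (toSite (ctrOff (d + 1) Lc)) Lc
                  (fun l x => (if l = α then ((Lc : ℝ) ^ 2)⁻¹ * (((x β % (Lc : ℤ) : ℤ)) : ℝ) else 0)
                    - (if l = β then (Lc : ℝ)⁻¹ * (if x β % (Lc : ℤ) = (Lc : ℤ) - 1 then (1 : ℝ) else 0) * (((x α % (Lc : ℤ) : ℤ)) : ℝ) else 0)) l v) κ Y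
              - ((Lc : ℝ) ^ (d + 1))⁻¹ * (contourSum Lc
                (fun l v => c * axProjAt (toSite (ctrOff (d + 1) Lc)) Lc
                  (fun l x => (if l = α then ((Lc : ℝ) ^ 2)⁻¹ * (((x β % (Lc : ℤ) : ℤ)) : ℝ) else 0)
                    - (if l = β then (Lc : ℝ)⁻¹ * (if x β % (Lc : ℤ) = (Lc : ℤ) - 1 then (1 : ℝ) else 0) * (((x α % (Lc : ℤ) : ℤ)) : ℝ) else 0)) l v) κ 0
                * (if Y κ % (Lc : ℤ) = (Lc : ℤ) - 1 then (1 : ℝ) else 0)))) = 0 := by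
  classical
  have hLc1 : 1 ≤ Lc := one_le_of_neZero Lc
  have hr := ctrOff_mem_box (d := d + 1) hLc1
  set G1 : MKer (d + 1) (Fib d) := coDressKBmAt (toSite (ctrOff (d + 1) Lc)) Lc (KInvStep (d := d) Lc (j + 1)) with hG1def
  -- the datum `n⋆` and the weight `m = σ⊙n⋆`
  set nS : Form1 (d + 1) ℝ := fun κ Y => (axProjAt (toSite (ctrOff (d + 1) Lc)) Lc
      (fun l v => c * axProjAt (toSite (ctrOff (d + 1) Lc)) Lc
        (fun l x => (if l = α then ((Lc : ℝ) ^ 2)⁻¹ * (((x β % (Lc : ℤ) : ℤ)) : ℝ) else 0)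
          - (if l = β then (Lc : ℝ)⁻¹ * (if x β % (Lc : ℤ) = (Lc : ℤ) - 1 then (1 : ℝ) else 0) * (((x α % (Lc : ℤ) : ℤ)) : ℝ) else 0)) l v) κ Y
    - ((Lc : ℝ) ^ (d + 1))⁻¹ * (contourSum Lc
      (fun l v => c * axProjAt (toSite (ctrOff (d + 1) Lc)) Lc
        (fun l x => (if l = α then ((Lc : ℝ) ^ 2)⁻¹ * (((x β % (Lc : ℤ) : ℤ)) : ℝ) else 0)
          - (if l = β then (Lc : ℝ)⁻¹ * (if x β % (Lc : ℤ) = (Lc : ℤ) - 1 then (1 : ℝ) else 0) * (((x α % (Lc : ℤ) : ℤ)) : ℝ) else 0)) l v) κ 0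
      * (if Y κ % (Lc : ℤ) = (Lc : ℤ) - 1 then (1 : ℝ) else 0))) with hnS
  obtain ⟨BS, hBS⟩ := exists_abs_explicitSourceForm_le (d := d) (Lc := Lc) (toSite (ctrOff (d + 1) Lc)) c α β
  have hnSb : ∀ κ Y, |nS κ Y| ≤ BS := fun κ Y => hBS κ Y
  set m : Form1 (d + 1) ℝ := fun κ Y => ((if blk Lc Y = y then (1 : ℝ) else 0) + (if blk Lc (Y + unitVec κ) = y then (1 : ℝ) else 0)) * nS κ Y with hm
  have hone : ∀ (Q : Prop) [Decidable Q], |(if Q then (1 : ℝ) else 0)| ≤ 1 := fun Q _ => by split <;> simp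
  have hBS0 : 0 ≤ BS := (abs_nonneg _).trans (hBS 0 0)
  have hmb : ∀ κ Y, |m κ Y| ≤ 2 * BS := fun κ Y => by
    rw [hm]
    simp only []
    rw [abs_mul]
    refine mul_le_mul (((abs_add_le _ _).trans (add_le_add (hone _) (hone _))).trans (by norm_num)) (hnSb κ Y) (abs_nonneg _) (by norm_num)
  -- the slot datum is summable along every direction
  have hh : ∀ l, Summable fun t : Site (d + 1) => colH G1 Lc ν y' l t := fun l => summable_colH hr (j + 1) ν y' l
  -- `C_0 h` in the `wΦ` letters, then (E3)
  set β' : Form1 (d + 1) ℝ := colM G1 Lc ν y' with hβ'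
  have hwVH : wVH d Lc (j + 1) ≠ 0 := by
    unfold BalabanStepJetsSucc.wVH; exact pow_ne_zero _ (pow_ne_zero _ (by exact_mod_cast NeZero.ne Lc))
  have hC : ∀ (κ : Fin (d + 1)) (Y : Site (d + 1)), (∑ l, ∑' t : Site (d + 1), colH G1 Lc ν y' l t
      * colM (coDressKBmAt (toSite (ctrOff (d + 1) Lc)) Lc (KInvStep (d := d) Lc j)) Lc l t κ Y)
      = (wVH d Lc (j + 1))⁻¹ * stepScale d Lc (j + 1) * contourSumAdj Lc β' κ Y := by
    intro κ Y
    rw [slotSum_mul_colM_eq hr j hh κ Y]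
    have hE3 := E2row_colH_eq_contourSumAdj_colM_succ (d := d) hr j ν y' κ Y
    rw [← hG1def] at hE3
    have e : (∑' t : Site (d + 1), ∑ l, wΦ (N := Lc ^ (j + 1)) κ l (Y - t) * colH G1 Lc ν y' l t)
        = (wVH d Lc (j + 1))⁻¹ * (wVH d Lc (j + 1) * ∑' v : Site (d + 1), ∑ l : Fin (d + 1), wΦ (N := Lc ^ (j + 1)) κ l (Y - v) * colH G1 Lc ν y' l v) := by
      rw [← mul_assoc, inv_mul_cancel₀ hwVH, one_mul]
    rw [e, hE3, hβ']
    ring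
  show ∑' Y : Site (d + 1), ∑ κ : Fin (d + 1), (∑ l, ∑' t : Site (d + 1), colH G1 Lc ν y' l t
      * colM (coDressKBmAt (toSite (ctrOff (d + 1) Lc)) Lc (KInvStep (d := d) Lc j)) Lc l t κ Y) * m κ Y = 0
  simp only [hC]
  -- adjointness
  obtain ⟨C1, δ1, hδ1, hG1d⟩ := spr_coDressKBmAt hLc1 hr (spr_KInvStep (d := d) (Lc := Lc) (j + 1))
  have hφ : ∀ κ, Summable fun u : Site (d + 1) => |β' κ (quo Lc u)| := fun κ => by
    have := summable_abs_comp_quo (N := Lc) hLc1 hδ1 hG1d ((Lc : ℤ) • y') (Sum.inr κ) (Sum.inr ν)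
    exact this.congr fun u => by simp only [hβ', hG1def, SecondOrderResponse.colM]
  have e1 : (∑' Y : Site (d + 1), ∑ κ : Fin (d + 1), (wVH d Lc (j + 1))⁻¹ * stepScale d Lc (j + 1) * contourSumAdj Lc β' κ Y * m κ Y)
      = (wVH d Lc (j + 1))⁻¹ * stepScale d Lc (j + 1) * ∑' Y : Site (d + 1), ∑ κ : Fin (d + 1), m κ Y * contourSumAdj Lc β' κ Y := by
    rw [← tsum_mul_left]
    refine tsum_congr fun Y => ?_
    rw [Finset.mul_sum]
    exact Finset.sum_congr rfl fun κ _ => by ring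
  rw [e1, tsum_mul_contourSumAdj_bdd (N := Lc) hmb hφ]
  -- (ΛS): every contour sum of `σ⊙n⋆` vanishes
  have hΛS : ∀ (κ : Fin (d + 1)) (w : Site (d + 1)), contourSum Lc m κ w = 0 := fun κ w => by
    rw [hm, hnS]
    exact contourSum_bondSum_blockInd_explicitSourceForm_eq_zero (d := d) hr hαβ c y κ w
  simp only [hΛS, mul_zero, Finset.sum_const_zero, tsum_zero]

/-- NOT IN PRINT; OUR BOOKKEEPING.  **THE TWO-LEVEL SLOT DATUM IS IN THE TOWER CLASS WITH `P = Lc`** (centred root, every `j`, every slot `(ν, y′)` of `G_{j+1}`): with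
`h = colH G_{j+1} Lc ν y′` and `β = (stepScale_{j+1}∕wVH_{j+1})·colM G_{j+1} Lc ν y′`: `h` is summable along every direction and bounded, `β κ` is summable, and
`C_j h = 𝒬ᵀ_{Lc} β` ((E3) `DataColumnCombRows.E2row_colH_eq_contourSumAdj_colM_succ` in the `colM` letters). -/
theorem twoLevel_mem_towerClass (j : ℕ) (ν : Fin (d + 1)) (y' : Site (d + 1)) :
    (∀ l, Summable fun t : Site (d + 1) => colH (coDressKBmAt (toSite (ctrOff (d + 1) Lc)) Lc (KInvStep (d := d) Lc (j + 1))) Lc ν y' l t)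
    ∧ (∃ Bh : ℝ, ∀ (l : Fin (d + 1)) (t : Site (d + 1)), |colH (coDressKBmAt (toSite (ctrOff (d + 1) Lc)) Lc (KInvStep (d := d) Lc (j + 1))) Lc ν y' l t| ≤ Bh)
    ∧ (∀ κ, Summable fun Y : Site (d + 1) =>
        ((wVH d Lc (j + 1))⁻¹ * stepScale d Lc (j + 1)) * colM (coDressKBmAt (toSite (ctrOff (d + 1) Lc)) Lc (KInvStep (d := d) Lc (j + 1))) Lc ν y' κ Y)
    ∧ (∀ (κ : Fin (d + 1)) (Y : Site (d + 1)), (∑ l, ∑' t : Site (d + 1), colH (coDressKBmAt (toSite (ctrOff (d + 1) Lc)) Lc (KInvStep (d := d) Lc (j + 1))) Lc ν y' l t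
          * colM (coDressKBmAt (toSite (ctrOff (d + 1) Lc)) Lc (KInvStep (d := d) Lc j)) Lc l t κ Y)
        = contourSumAdj Lc (fun μ w => ((wVH d Lc (j + 1))⁻¹ * stepScale d Lc (j + 1))
            * colM (coDressKBmAt (toSite (ctrOff (d + 1) Lc)) Lc (KInvStep (d := d) Lc (j + 1))) Lc ν y' μ w) κ Y) := by
  have hLc1 : 1 ≤ Lc := one_le_of_neZero Lc
  have hr := ctrOff_mem_box (d := d + 1) hLc1
  obtain ⟨δG, CG, hδG, hCG, hG⟩ := decays_coDressKBmAt_KInvStep (d := d) hr (j + 1)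
  set G1 : MKer (d + 1) (Fib d) := coDressKBmAt (toSite (ctrOff (d + 1) Lc)) Lc (KInvStep (d := d) Lc (j + 1)) with hG1def
  have hh : ∀ l, Summable fun t : Site (d + 1) => colH G1 Lc ν y' l t := fun l => summable_colH hr (j + 1) ν y' l
  have hwVH : wVH d Lc (j + 1) ≠ 0 := by
    unfold BalabanStepJetsSucc.wVH; exact pow_ne_zero _ (pow_ne_zero _ (by exact_mod_cast NeZero.ne Lc))
  refine ⟨hh, ⟨CG, fun l t => (hG t ((Lc : ℤ) • y') (Sum.inl l) (Sum.inr ν)).trans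
    (mul_le_of_le_one_right hCG (by rw [Real.exp_le_one_iff]; have := l1_nonneg (t - (Lc : ℤ) • y'); nlinarith))⟩, fun κ => ?_, fun κ Y => ?_⟩
  · have hc : Summable fun Y : Site (d + 1) => colM G1 Lc ν y' κ Y := by
      refine Summable.of_norm_bounded ((summable_exp_shift' (D := d + 1) hδG y').mul_left CG) (fun Y => ?_)
      rw [Real.norm_eq_abs]
      exact abs_colM_le_fine (N := Lc) hG hδG.le ν y' κ Y
    exact hc.mul_left _
  · rw [slotSum_mul_colM_eq hr j hh κ Y, BornLambdaTent.contourSumAdj_const_mul]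
    have hE3 := E2row_colH_eq_contourSumAdj_colM_succ (d := d) hr j ν y' κ Y
    rw [← hG1def] at hE3
    have e : (∑' t : Site (d + 1), ∑ l, wΦ (N := Lc ^ (j + 1)) κ l (Y - t) * colH G1 Lc ν y' l t)
        = (wVH d Lc (j + 1))⁻¹ * (wVH d Lc (j + 1) * ∑' v : Site (d + 1), ∑ l : Fin (d + 1), wΦ (N := Lc ^ (j + 1)) κ l (Y - v) * colH G1 Lc ν y' l v) := by
      rw [← mul_assoc, inv_mul_cancel₀ hwVH, one_mul]
    rw [e, hE3]
    ring

/-! ## §3 Road-P2's `hX` at every `j` -/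

/-- NOT IN PRINT; OUR BOOKKEEPING.  **ROAD-P2's `hX` AT EVERY LEVEL `j`, AT BAŁABAN's PINS** (`Lc` odd, centred root `ρ = toSite (ctrOff (d+1) Lc)`, `cE = Lc^{d+1}`,
`cVH = −(Lc^{d+1}·½·Lc^{d+1})`, EVERY `cΛ`, `α ≠ β`, every block label `y`, every `ν`): the displayed hypothesis `hX` of
`ExplicitSourceFormLambdaShare.moments_sigmaPair_exit_succ_of_columnPairing` at every `j` — for every slot position `y′` and every `c`, IF the exit⊗exit charge of `SpureRecAt … (0+1)`
is `wVH_1·Σ'_v Σ_l wΦ_{Lc} ν l (y′ − v)·(c·Π^ρ m̃)(l,v)` at every coarse bond, THEN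
`(cE·wE_1)·X_1(colH G_1(ν,y′); n⋆_c, 1_{B(y)}) = −½·stepScale_1·Lc^{d+1}·Σ'_u Σ_κ 1_{B(y)}(u + e_κ)·colH G_1 Lc ν y′ κ u·C^{ee}(S_1)(κ,u)`
— PART 2's closed form at `n := n⋆` (road-P2's `ExplicitSourceFormPeriodic` for the two hypotheses), §3 (the `σ`-term vanishes), §2 (`C_0 n⋆ = C_0(c·Π^ρ m̃)`), the weight identity
`cE·wE_1 = stepScale_1·Lc^{d+1}·wVH_1`. -/
theorem columnPairing_explicitSourceForm (hLc : Odd Lc) (cΛ : ℝ) (j : ℕ) (y : Site (d + 1)) (ν : Fin (d + 1)) {α β : Fin (d + 1)} (hαβ : α ≠ β)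
    (y' : Site (d + 1)) (c : ℝ)
    (hC : ∀ (ν : Fin (d + 1)) (y' : Site (d + 1)), ∑' xz : Site (d + 1) × Site (d + 1),
        (if xz.1 α % (Lc : ℤ) = (Lc : ℤ) - 1 then (1 : ℝ) else 0) * (if xz.2 β % (Lc : ℤ) = (Lc : ℤ) - 1 then (1 : ℝ) else 0)
          * SpureRecAt d Lc (toSite (ctrOff (d + 1) Lc)) ((Lc : ℝ) ^ (d + 1)) (-((Lc : ℝ) ^ (d + 1) * (1 / 2) * (Lc : ℝ) ^ (d + 1))) cΛ (j + 1)
              ν y' xz.1 xz.2 (Sum.inl α) (Sum.inl β)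
        = wVH d Lc (j + 1) * ∑' v, ∑ l : Fin (d + 1), wΦ (N := Lc ^ (j + 1)) ν l (y' - v) * (c * axProjAt (toSite (ctrOff (d + 1) Lc)) Lc
            (fun l x => (if l = α then ((Lc : ℝ) ^ 2)⁻¹ * (((x β % (Lc : ℤ) : ℤ)) : ℝ) else 0)
              - (if l = β then (Lc : ℝ)⁻¹ * (if x β % (Lc : ℤ) = (Lc : ℤ) - 1 then (1 : ℝ) else 0) * (((x α % (Lc : ℤ) : ℤ)) : ℝ) else 0)) l v)) :
    ((Lc : ℝ) ^ (d + 1) * wE d Lc (j + 1)) * (∑ l, ∑' t, colH (coDressKBmAt (toSite (ctrOff (d + 1) Lc)) Lc (KInvStep (d := d) Lc (j + 1))) Lc ν y' l t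
          * ∑' ux : Site (d + 1) × Site (d + 1), ∑ κ, ∑ κ₂,
              (axProjAt (toSite (ctrOff (d + 1) Lc)) Lc
                  (fun l v => c * axProjAt (toSite (ctrOff (d + 1) Lc)) Lc
                (fun l x => (if l = α then ((Lc : ℝ) ^ 2)⁻¹ * (((x β % (Lc : ℤ) : ℤ)) : ℝ) else 0)
              - (if l = β then (Lc : ℝ)⁻¹ * (if x β % (Lc : ℤ) = (Lc : ℤ) - 1 then (1 : ℝ) else 0) * (((x α % (Lc : ℤ) : ℤ)) : ℝ) else 0)) l v) κ ux.1
                - ((Lc : ℝ) ^ (d + 1))⁻¹ * (contourSum Lc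
                  (fun l v => c * axProjAt (toSite (ctrOff (d + 1) Lc)) Lc
                (fun l x => (if l = α then ((Lc : ℝ) ^ 2)⁻¹ * (((x β % (Lc : ℤ) : ℤ)) : ℝ) else 0)
              - (if l = β then (Lc : ℝ)⁻¹ * (if x β % (Lc : ℤ) = (Lc : ℤ) - 1 then (1 : ℝ) else 0) * (((x α % (Lc : ℤ) : ℤ)) : ℝ) else 0)) l v) κ 0
                  * (if ux.1 κ % (Lc : ℤ) = (Lc : ℤ) - 1 then (1 : ℝ) else 0)))
              * dz (fun z : Site (d + 1) => if blk Lc z = y then (1 : ℝ) else 0) κ₂ ux.2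
              * e3OfK Lc (coDressKBmAt (toSite (ctrOff (d + 1) Lc)) Lc (KInvStep (d := d) Lc j))
                  (SrecAt d Lc (toSite (ctrOff (d + 1) Lc)) ((Lc : ℝ) ^ (d + 1)) (-((Lc : ℝ) ^ (d + 1) * (1 / 2) * (Lc : ℝ) ^ (d + 1))) cΛ j)
                  l t ux.1 ux.2 (Sum.inl κ) (Sum.inl κ₂))
        = (-(stepScale d Lc (j + 1) * (Lc : ℝ) ^ (d + 1)) / 2) * ∑' u : Site (d + 1), ∑ κ : Fin (d + 1), (if blk Lc (u + Pi.single κ 1) = y then (1 : ℝ) else 0)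
            * colH (coDressKBmAt (toSite (ctrOff (d + 1) Lc)) Lc (KInvStep (d := d) Lc (j + 1))) Lc ν y' κ u
            * ∑' xz : Site (d + 1) × Site (d + 1), ((if xz.1 α % (Lc : ℤ) = (Lc : ℤ) - 1 then (1 : ℝ) else 0) * (if xz.2 β % (Lc : ℤ) = (Lc : ℤ) - 1 then (1 : ℝ) else 0))
            * SpureRecAt d Lc (toSite (ctrOff (d + 1) Lc)) ((Lc : ℝ) ^ (d + 1)) (-((Lc : ℝ) ^ (d + 1) * (1 / 2) * (Lc : ℝ) ^ (d + 1))) cΛ (j + 1)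
                κ u xz.1 xz.2 (Sum.inl α) (Sum.inl β) := by
  classical
  have hLc1 : 1 ≤ Lc := one_le_of_neZero Lc
  have hr := ctrOff_mem_box (d := d + 1) hLc1
  -- the two hypotheses of the datum `n⋆`
  obtain ⟨BS, hBS⟩ := exists_abs_explicitSourceForm_le (d := d) (Lc := Lc) (toSite (ctrOff (d + 1) Lc)) c α β
  have hper := fun (l : Fin (d + 1)) (t z : Site (d + 1)) => explicitSourceForm_blockPeriodic (d := d) (Lc := Lc) (toSite (ctrOff (d + 1) Lc)) c α β l t z
  -- the tower closed form at `P := Lc` for the two-level slot datum, at `n := n⋆`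
  obtain ⟨hh, ⟨Bh, hhB⟩, hβ, hCh⟩ := twoLevel_mem_towerClass (d := d) (Lc := Lc) j ν y'
  rw [sourcePairing_tower_closed (d := d) hLc cΛ j (P := Lc) hh hhB hβ hCh hBS hper y,
    sigmaWeight_multResponse_explicitSourceForm_eq_zero_level (d := d) (Lc := Lc) j hαβ c ν y' y, mul_zero, add_zero]
  -- `C_j n⋆ = C_j (c·Π^ρ m̃)`, the hypothesis on the exit⊗exit charge
  simp only [multResponse_explicitSourceForm_eq_level hr j c α β]
  -- summability of the slot family (the multiplier response of bounded data is bounded)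
  obtain ⟨BP, hBP⟩ := exists_abs_le_of_blockPeriodic hLc1 (fun l v => c * axProjAt (toSite (ctrOff (d + 1) Lc)) Lc
      (fun l x => (if l = α then ((Lc : ℝ) ^ 2)⁻¹ * (((x β % (Lc : ℤ) : ℤ)) : ℝ) else 0)
        - (if l = β then (Lc : ℝ)⁻¹ * (if x β % (Lc : ℤ) = (Lc : ℤ) - 1 then (1 : ℝ) else 0) * (((x α % (Lc : ℤ) : ℤ)) : ℝ) else 0)) l v)
    (fun l v z => explicitPotential_blockPeriodic (d := d) (Lc := Lc) (toSite (ctrOff (d + 1) Lc)) c α β l v z)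
  set W : Form1 (d + 1) ℝ := fun l t => ∑' v : Site (d + 1), ∑ l' : Fin (d + 1), wΦ (N := Lc ^ (j + 1)) l l' (t - v)
      * (c * axProjAt (toSite (ctrOff (d + 1) Lc)) Lc
          (fun l x => (if l = α then ((Lc : ℝ) ^ 2)⁻¹ * (((x β % (Lc : ℤ) : ℤ)) : ℝ) else 0)
            - (if l = β then (Lc : ℝ)⁻¹ * (if x β % (Lc : ℤ) = (Lc : ℤ) - 1 then (1 : ℝ) else 0) * (((x α % (Lc : ℤ) : ℤ)) : ℝ) else 0)) l' v) with hW
  have hC' : ∀ (κ : Fin (d + 1)) (u : Site (d + 1)), (∑' xz : Site (d + 1) × Site (d + 1),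
      (if xz.1 α % (Lc : ℤ) = (Lc : ℤ) - 1 then (1 : ℝ) else 0) * (if xz.2 β % (Lc : ℤ) = (Lc : ℤ) - 1 then (1 : ℝ) else 0)
        * SpureRecAt d Lc (toSite (ctrOff (d + 1) Lc)) ((Lc : ℝ) ^ (d + 1)) (-((Lc : ℝ) ^ (d + 1) * (1 / 2) * (Lc : ℝ) ^ (d + 1))) cΛ (j + 1)
            κ u xz.1 xz.2 (Sum.inl α) (Sum.inl β)) = wVH d Lc (j + 1) * W κ u := fun κ u => hC κ u
  -- the multiplier response of `c·Π^ρ m̃` is bounded: it is `C_0` of bounded data (`colM G_0 = wΦ_{Lc}`)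
  obtain ⟨BC, hBC0, hCb⟩ := abs_multResponse_le (d := d) hr j hBP
  have hWb : ∀ (l : Fin (d + 1)) (t : Site (d + 1)), |W l t| ≤ BC := by
    intro l t
    have e : W l t = ∑ κ₀, ∑' u : Site (d + 1), (c * axProjAt (toSite (ctrOff (d + 1) Lc)) Lc
        (fun l x => (if l = α then ((Lc : ℝ) ^ 2)⁻¹ * (((x β % (Lc : ℤ) : ℤ)) : ℝ) else 0)
          - (if l = β then (Lc : ℝ)⁻¹ * (if x β % (Lc : ℤ) = (Lc : ℤ) - 1 then (1 : ℝ) else 0) * (((x α % (Lc : ℤ) : ℤ)) : ℝ) else 0)) κ₀ u)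
        * colM (coDressKBmAt (toSite (ctrOff (d + 1) Lc)) Lc (KInvStep (d := d) Lc j)) Lc κ₀ u l t := by
      rw [hW]
      simp only []
      rw [← Summable.tsum_finsetSum (fun κ₀ _ => (hCb l t).1 κ₀)]
      refine tsum_congr fun u => Finset.sum_congr rfl fun κ₀ _ => ?_
      rw [colM_coDressKBmAt, colM_KInvStep]
      ring
    rw [e]
    exact (hCb l t).2
  -- both sides as the same double sum
  have hsum : ∀ l, Summable fun t : Site (d + 1) => colH (coDressKBmAt (toSite (ctrOff (d + 1) Lc)) Lc (KInvStep (d := d) Lc (j + 1))) Lc ν y' l t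
      * ((if blk Lc (t + unitVec l) = y then (1 : ℝ) else 0) * W l t) := fun l =>
    (summable_bdd_mul (hh l) (fun t => show |(if blk Lc (t + unitVec l) = y then (1 : ℝ) else 0) * W l t| ≤ 1 * BC by
      rw [abs_mul]; exact mul_le_mul (by split_ifs <;> simp) (hWb l t) (abs_nonneg _) zero_le_one)).congr fun t => by ring
  have eU : ∀ (κ : Fin (d + 1)) (u : Site (d + 1)), u + Pi.single κ (1 : ℤ) = u + unitVec κ := fun κ u => rfl
  simp only [hC', eU]
  rw [Summable.tsum_finsetSum (fun l _ => ((hsum l).mul_left (wVH d Lc (j + 1))).congr fun t => by ring)]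
  have hw : (Lc : ℝ) ^ (d + 1) * wE d Lc (j + 1) = stepScale d Lc (j + 1) * (Lc : ℝ) ^ (d + 1) * wVH d Lc (j + 1) := by
    unfold BalabanStepJetsSucc.wE BalabanStepJetsSucc.wVH BorderedHessian.stepScale
    ring
  -- fold the multiplier response of `c·Π^ρ m̃` into `W` on the left
  have hW' : ∀ (l : Fin (d + 1)) (t : Site (d + 1)), (∑' v : Site (d + 1), ∑ l' : Fin (d + 1), wΦ (N := Lc ^ (j + 1)) l l' (t - v)
      * (c * axProjAt (toSite (ctrOff (d + 1) Lc)) Lc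
          (fun l x => (if l = α then ((Lc : ℝ) ^ 2)⁻¹ * (((x β % (Lc : ℤ) : ℤ)) : ℝ) else 0)
            - (if l = β then (Lc : ℝ)⁻¹ * (if x β % (Lc : ℤ) = (Lc : ℤ) - 1 then (1 : ℝ) else 0) * (((x α % (Lc : ℤ) : ℤ)) : ℝ) else 0)) l' v)) = W l t :=
    fun l t => rfl
  simp only [hW']
  rw [hw]
  simp only [Finset.mul_sum, ← tsum_mul_left]
  refine Finset.sum_congr rfl fun l _ => tsum_congr fun t => ?_
  ring

end Summit.QuantumFields.BalabanUV.Beta.GAN24.SourcePairingLevelExplicit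

end
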